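import Summits.CriticalPhenomena.PercolationContinuityZ3.Theorems.PercNearOneGluingNoHeavyConstsLinearLowerTailThreeHalvesPartial
import Literature.Probability.Percolation.KozmaNitzanPreFKG
import HarnessLib

/-!
# (LT³⁄₂) for five relay points: the first case beyond the pair-marginal barrier

builds on p205010 (kernel theorem, internal audit signed; external expert review pending)

PAPER-2 track "percolation constants", part (ii), seat `prim-consts-1` (lane index `run/shared/lean/prim/consts/CONSTANTS.md`,
row A19, §4 N18).  Support file for the crux `NoHeavyLowerTail` (stmt-CriticalPhenomena-4575; `--supports … --as helper`):
theorems only, standard axioms.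

The conjecture `Consts.LinearLowerTailThreeHalves` (`…ConstsLinearLowerTailConjecture`) asks, for `0 < κ ≤ 2/3` and every finite
weighted graph, relay set `A`, observer `o` and `s ≥ max P(a ↮ a')`, that `P(1 ≤ N < κ·EN) ≤ (3/2)·s`.  Proved so far
(`…ThreeHalvesPartial`, `…GluedGroups`, `…GluedDust`): `κ ≤ 1/3`; `|A| ≤ 3`; `o ∈ A` with `κ|A| ≤ 3` (so `|A| ≤ 4`); the clustered
class.  All of these follow from POINTWISE charging of the bad event to cut pairs.  For `|A| = 5` with `o ∈ A` this is no longer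
possible: the best pointwise pair-charging bound is `7/4` (the fractional law "o isolated w.p. `s/4`, each 2-subset of the other
four points lost w.p. `s/4`" meets every pair budget with value `7/4`), so a percolation-specific input is needed.  This file
supplies it: van den Berg–Häggström–Kahn's conditional positive association of the cluster of `o` given `{o ↮ xᵢ}` (Thm. 1.3,
kernel theorem `BHK2006_clusterConditionalPositiveAssociation_holds`, event form `KNPreFKG.bhk_one_upper_upper`), applied four
times — "given that `o` loses `xᵢ`, keeping `x_k` and keeping `{x_j, x_l}` are positively correlated" — kills the `7/4` law
(lost sets of fixed size two are negatively associated) and, together with the ten pair budgets, yields exactly `3/2` through a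
degree-2 Positivstellensatz certificate with 54 rational terms (found by LP, kit jobs j122476/j122590 of this seat; the identity
is re-checked here by `linarith` over the expanded products).

* `Consts.Five.core` — the real-arithmetic certificate: for nonnegative masses `e T`, `T ⊆ Fin 4` (lost set of `o` exactly
  `{x_k : k ∈ T}`), the four observer budgets, five of the six relay-pair budgets and the four positive-association
  inequalities imply `Σ_{|T| ≥ 2} e T ≤ (3/2)·s`.
* `Consts.Five.real_setOf_lostSet` — fibre decomposition of any event determined by the lost set of `o` among four marked points.
* `Consts.Five.key` — the positive-association inequality in event form:
  `μ(o↮xᵢ, o↔x_k)·μ(o↮xᵢ, o↔x_j, o↔x_l) ≤ μ(o↮xᵢ)·μ(o↮xᵢ, o↔x_j, o↔x_k, o↔x_l)`.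
* `Consts.real_two_le_lost_le_three_halves` — for an observer `o` and four further points with all ten pairwise
  unreliabilities `≤ s`: `μ(o is cut from at least two of the four) ≤ (3/2)·s` (sharp: the hub-leaf gadget).
* `Consts.real_lowerTail_le_three_halves_of_card_le_five`, `Consts.linearLowerTailThreeHalves_of_card_le_five` — (LT³⁄₂) for
  every instance with `o ∈ A`, `|A| ≤ 5`, every `κ ≤ 2/3` (all weights, all `s`), in the conjecture's quantifier shape.

References: J. van den Berg, O. Häggström, J. Kahn, Random Structures Algorithms 29 (2006) 417–435, Thm. 1.3 (p. 6);
G. Kozma, N. Nitzan, arXiv:2401.12397 (2024), Conjecture 1 (p. 3); G. Grimmett, *Percolation* (1999), §2.2.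
-/

noncomputable section

namespace Summit.CriticalPhenomena.PercolationContinuityZ3.Theorems

open MeasureTheory Set Literature.Probability.LatticeModels Literature.Probability.Percolation
open scoped Classical

namespace Consts

/-- **The degree-2 certificate.**  Nonnegative masses `e T` (`T ⊆ Fin 4`; read: the lost set of the observer among four marked
relay points is exactly `T`), the four observer budgets `Σ_{T ∋ i} e T ≤ s`, five relay-pair budgets `Σ_{|T ∩ {i,k}| = 1} e T ≤ s`
and four positive-association inequalities (vdBHK Thm. 1.3 given `{o ↮ xᵢ}`, for `(i,k) = (0,2), (2,0), (1,3), (3,1)`) imply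
`Σ_{|T| ≥ 2} e T ≤ (3/2)·s`.  Proof: `s·((3/2)s − Σ_{|T|≥2} e T)` is an explicit nonnegative rational combination of 54 products of
the hypotheses (coefficients in `{1/8, 1/4, 3/8, 1/2}`; kit j122590), checked by `linarith` on the expanded monomials.
[cite: VandenbergHaggstromKahn2005, Thm. 1.3 (p. 6)] -/
theorem Five.core (e : Finset (Fin 4) → ℝ) (s : ℝ) (he : ∀ T, 0 ≤ e T)
    (hb0 : e {0} + e {0, 1} + e {0, 2} + e {0, 1, 2} + e {0, 3} + e {0, 1, 3} + e {0, 2, 3} + e {0, 1, 2, 3} ≤ s)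
    (hb1 : e {1} + e {0, 1} + e {1, 2} + e {0, 1, 2} + e {1, 3} + e {0, 1, 3} + e {1, 2, 3} + e {0, 1, 2, 3} ≤ s)
    (hb2 : e {2} + e {0, 2} + e {1, 2} + e {0, 1, 2} + e {2, 3} + e {0, 2, 3} + e {1, 2, 3} + e {0, 1, 2, 3} ≤ s)
    (hb3 : e {3} + e {0, 3} + e {1, 3} + e {0, 1, 3} + e {2, 3} + e {0, 2, 3} + e {1, 2, 3} + e {0, 1, 2, 3} ≤ s)
    (hp01 : e {0} + e {1} + e {0, 2} + e {1, 2} + e {0, 3} + e {1, 3} + e {0, 2, 3} + e {1, 2, 3} ≤ s)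
    (hp02 : e {0} + e {0, 1} + e {2} + e {1, 2} + e {0, 3} + e {0, 1, 3} + e {2, 3} + e {1, 2, 3} ≤ s)
    (hp12 : e {1} + e {0, 1} + e {2} + e {0, 2} + e {1, 3} + e {0, 1, 3} + e {2, 3} + e {0, 2, 3} ≤ s)
    (hp13 : e {1} + e {0, 1} + e {1, 2} + e {0, 1, 2} + e {3} + e {0, 3} + e {2, 3} + e {0, 2, 3} ≤ s)
    (hp23 : e {2} + e {0, 2} + e {1, 2} + e {0, 1, 2} + e {3} + e {0, 3} + e {1, 3} + e {0, 1, 3} ≤ s)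
    (hk02 : (e {0} + e {0, 1} + e {0, 3} + e {0, 1, 3}) * (e {0} + e {0, 2}) ≤ (e {0} + e {0, 1} + e {0, 2} + e {0, 1, 2} + e {0, 3} + e {0, 1, 3} + e {0, 2, 3} + e {0, 1, 2, 3}) * e {0})
    (hk20 : (e {2} + e {1, 2} + e {2, 3} + e {1, 2, 3}) * (e {2} + e {0, 2}) ≤ (e {2} + e {0, 2} + e {1, 2} + e {0, 1, 2} + e {2, 3} + e {0, 2, 3} + e {1, 2, 3} + e {0, 1, 2, 3}) * e {2})
    (hk13 : (e {1} + e {0, 1} + e {1, 2} + e {0, 1, 2}) * (e {1} + e {1, 3}) ≤ (e {1} + e {0, 1} + e {1, 2} + e {0, 1, 2} + e {1, 3} + e {0, 1, 3} + e {1, 2, 3} + e {0, 1, 2, 3}) * e {1})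
    (hk31 : (e {3} + e {0, 3} + e {2, 3} + e {0, 2, 3}) * (e {3} + e {1, 3}) ≤ (e {3} + e {0, 3} + e {1, 3} + e {0, 1, 3} + e {2, 3} + e {0, 2, 3} + e {1, 2, 3} + e {0, 1, 2, 3}) * e {3})
    : e {0, 1} + e {0, 2} + e {1, 2} + e {0, 1, 2} + e {0, 3} + e {1, 3} + e {0, 1, 3} + e {2, 3} + e {0, 2, 3} + e {1, 2, 3} + e {0, 1, 2, 3} ≤ 3 / 2 * s := by
  -- nonnegativity of the budget slacks and of the four association gaps
  have hB0 : 0 ≤ s - (e {0} + e {0, 1} + e {0, 2} + e {0, 1, 2} + e {0, 3} + e {0, 1, 3} + e {0, 2, 3} + e {0, 1, 2, 3}) := sub_nonneg.2 hb0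
  have hB1 : 0 ≤ s - (e {1} + e {0, 1} + e {1, 2} + e {0, 1, 2} + e {1, 3} + e {0, 1, 3} + e {1, 2, 3} + e {0, 1, 2, 3}) := sub_nonneg.2 hb1
  have hB2 : 0 ≤ s - (e {2} + e {0, 2} + e {1, 2} + e {0, 1, 2} + e {2, 3} + e {0, 2, 3} + e {1, 2, 3} + e {0, 1, 2, 3}) := sub_nonneg.2 hb2
  have hB3 : 0 ≤ s - (e {3} + e {0, 3} + e {1, 3} + e {0, 1, 3} + e {2, 3} + e {0, 2, 3} + e {1, 2, 3} + e {0, 1, 2, 3}) := sub_nonneg.2 hb3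
  have hP01 : 0 ≤ s - (e {0} + e {1} + e {0, 2} + e {1, 2} + e {0, 3} + e {1, 3} + e {0, 2, 3} + e {1, 2, 3}) := sub_nonneg.2 hp01
  have hP02 : 0 ≤ s - (e {0} + e {0, 1} + e {2} + e {1, 2} + e {0, 3} + e {0, 1, 3} + e {2, 3} + e {1, 2, 3}) := sub_nonneg.2 hp02
  have hP12 : 0 ≤ s - (e {1} + e {0, 1} + e {2} + e {0, 2} + e {1, 3} + e {0, 1, 3} + e {2, 3} + e {0, 2, 3}) := sub_nonneg.2 hp12
  have hP13 : 0 ≤ s - (e {1} + e {0, 1} + e {1, 2} + e {0, 1, 2} + e {3} + e {0, 3} + e {2, 3} + e {0, 2, 3}) := sub_nonneg.2 hp13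
  have hP23 : 0 ≤ s - (e {2} + e {0, 2} + e {1, 2} + e {0, 1, 2} + e {3} + e {0, 3} + e {1, 3} + e {0, 1, 3}) := sub_nonneg.2 hp23
  have hK02 : 0 ≤ (e {0} + e {0, 1} + e {0, 2} + e {0, 1, 2} + e {0, 3} + e {0, 1, 3} + e {0, 2, 3} + e {0, 1, 2, 3}) * e {0} - (e {0} + e {0, 1} + e {0, 3} + e {0, 1, 3}) * (e {0} + e {0, 2}) := sub_nonneg.2 hk02
  have hK20 : 0 ≤ (e {2} + e {0, 2} + e {1, 2} + e {0, 1, 2} + e {2, 3} + e {0, 2, 3} + e {1, 2, 3} + e {0, 1, 2, 3}) * e {2} - (e {2} + e {1, 2} + e {2, 3} + e {1, 2, 3}) * (e {2} + e {0, 2}) := sub_nonneg.2 hk20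
  have hK13 : 0 ≤ (e {1} + e {0, 1} + e {1, 2} + e {0, 1, 2} + e {1, 3} + e {0, 1, 3} + e {1, 2, 3} + e {0, 1, 2, 3}) * e {1} - (e {1} + e {0, 1} + e {1, 2} + e {0, 1, 2}) * (e {1} + e {1, 3}) := sub_nonneg.2 hk13
  have hK31 : 0 ≤ (e {3} + e {0, 3} + e {1, 3} + e {0, 1, 3} + e {2, 3} + e {0, 2, 3} + e {1, 2, 3} + e {0, 1, 2, 3}) * e {3} - (e {3} + e {0, 3} + e {2, 3} + e {0, 2, 3}) * (e {3} + e {1, 3}) := sub_nonneg.2 hk31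
  by_cases hs0 : s ≤ 0
  · -- then every lost-set mass of size ≥ 2 vanishes
    linarith [he {0}, he {1}, he {0, 1}, he {2}, he {0, 2}, he {1, 2}, he {0, 1, 2}, he {3}, he {0, 3}, he {1, 3}, he {0, 1, 3}, he {2, 3}, he {0, 2, 3}, he {1, 2, 3}, he {0, 1, 2, 3}, hb0, hb1, hb2, hb3]
  have hs : 0 < s := lt_of_not_ge hs0
  -- the degree-2 certificate: 54 nonnegative products with coefficients in {1/8, 1/4, 3/8, 1/2} (kit j122590)
  have hmain : 0 ≤ s * (3 / 2 * s - (e {0, 1} + e {0, 2} + e {1, 2} + e {0, 1, 2} + e {0, 3} + e {1, 3} + e {0, 1, 3} + e {2, 3} + e {0, 2, 3} + e {1, 2, 3} + e {0, 1, 2, 3})) := by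
    linarith [mul_nonneg hs.le (he {0}), mul_nonneg hs.le (he {1}), mul_nonneg hs.le (he {2}),
      mul_nonneg hs.le (he {3}), mul_nonneg hs.le hB0, mul_nonneg hs.le hB2,
      mul_nonneg hs.le hB3, hK02, hK13,
      hK20, hK31, mul_nonneg (he {0}) hB0,
      mul_nonneg (he {0}) hB1, mul_nonneg (he {0}) hB2, mul_nonneg (he {1}) hB0,
      mul_nonneg (he {1}) hB1, mul_nonneg (he {1}) hB3, mul_nonneg (he {2}) hB0,
      mul_nonneg (he {2}) hB1, mul_nonneg (he {2}) hB2, mul_nonneg (he {3}) hB0,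
      mul_nonneg (he {3}) hB1, mul_nonneg (he {3}) hB2, mul_nonneg (he {3}) hB3,
      mul_nonneg (he {0, 1}) hB0, mul_nonneg (he {0, 2}) hB1, mul_nonneg (he {0, 3}) hB2,
      mul_nonneg (he {0, 3}) hP02, mul_nonneg (he {0, 3}) hP13, mul_nonneg (he {1, 2}) hB0,
      mul_nonneg (he {1, 2}) hB1, mul_nonneg (he {1, 2}) hP13, mul_nonneg (he {1, 3}) hB0,
      mul_nonneg (he {2, 3}) hB1, mul_nonneg (he {2, 3}) hB2, mul_nonneg (he {2, 3}) hP02,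
      mul_nonneg (he {0, 1, 2}) hB0, mul_nonneg (he {0, 1, 3}) hB1, mul_nonneg (he {0, 1, 3}) hP13,
      mul_nonneg (he {0, 2, 3}) hB0, mul_nonneg (he {0, 2, 3}) hB2, mul_nonneg (he {0, 2, 3}) hP02,
      mul_nonneg (he {1, 2, 3}) hB1, mul_nonneg (he {1, 2, 3}) hP13, mul_nonneg (he {0, 1, 2, 3}) hB0,
      mul_nonneg (he {0, 1, 2, 3}) hB1, mul_nonneg hB1 hB2, mul_nonneg hB2 hB3,
      mul_nonneg hB2 hP02, mul_nonneg hB3 hP13, mul_nonneg hP01 hP02,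
      mul_nonneg hP01 hP13, mul_nonneg hP02 hP12, mul_nonneg hP13 hP23]
  by_contra hlt
  push Not at hlt
  have hneg : s * (3 / 2 * s - (e {0, 1} + e {0, 2} + e {1, 2} + e {0, 1, 2} + e {0, 3} + e {1, 3} + e {0, 1, 3} + e {2, 3} + e {0, 2, 3} + e {1, 2, 3} + e {0, 1, 2, 3})) < 0 := mul_neg_of_pos_of_neg hs (by linarith)
  linarith

namespace Five

variable {n : ℕ}

/-- A sum over all subsets of `Fin 4`, written out. [folklore] -/
theorem sum_finset_fin4 (g : Finset (Fin 4) → ℝ) :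
    ∑ T, g T = g ∅ + g {0} + g {1} + g {0, 1} + g {2} + g {0, 2} + g {1, 2} + g {0, 1, 2} + g {3} + g {0, 3} + g {1, 3} +
      g {0, 1, 3} + g {2, 3} + g {0, 2, 3} + g {1, 2, 3} + g {0, 1, 2, 3} := by
  have huniv : (Finset.univ : Finset (Finset (Fin 4))) =
      {∅, {0}, {1}, {0, 1}, {2}, {0, 2}, {1, 2}, {0, 1, 2}, {3}, {0, 3}, {1, 3}, {0, 1, 3}, {2, 3}, {0, 2, 3}, {1, 2, 3},
        {0, 1, 2, 3}} := by
    decide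
  rw [huniv]
  rw [Finset.sum_insert (by decide), Finset.sum_insert (by decide), Finset.sum_insert (by decide),
    Finset.sum_insert (by decide), Finset.sum_insert (by decide), Finset.sum_insert (by decide),
    Finset.sum_insert (by decide), Finset.sum_insert (by decide), Finset.sum_insert (by decide),
    Finset.sum_insert (by decide), Finset.sum_insert (by decide), Finset.sum_insert (by decide),
    Finset.sum_insert (by decide), Finset.sum_insert (by decide), Finset.sum_insert (by decide), Finset.sum_singleton]
  ring

/-- **Fibre decomposition**: the probability of an event determined by the LOST SET of `o` among four marked points
`x 0, …, x 3` (the indices `k` with `o ↮ x k`) is the sum, over the lost sets `T` satisfying it, of the fibre masses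
`μ(lost set = T)`. [folklore] -/
theorem real_setOf_lostSet (w : Sym2 (Fin n) → unitInterval) (o : Fin n) (x : Fin 4 → Fin n)
    (P : Finset (Fin 4) → Prop) [DecidablePred P] :
    (prodBernoulli w).real {ω | P (Finset.univ.filter fun k => ω ∉ openConn o (x k))} =
      ∑ T, if P T then (prodBernoulli w).real {ω | (Finset.univ.filter fun k => ω ∉ openConn o (x k)) = T} else 0 := by
  set L : BondConfig (Fin n) → Finset (Fin 4) := fun ω => Finset.univ.filter fun k => ω ∉ openConn o (x k) with hL
  have hset : {ω : BondConfig (Fin n) | P (L ω)} = L ⁻¹' ↑(Finset.univ.filter P) := by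
    ext ω; simp
  change (prodBernoulli w).real {ω | P (L ω)} = ∑ T, if P T then (prodBernoulli w).real {ω | L ω = T} else 0
  rw [hset, ← sum_measureReal_preimage_singleton (Finset.univ.filter P) (fun _ _ => MeasurableSet.of_discrete),
    Finset.sum_filter]
  rfl

/-- **The anti-halving input, event form** (van den Berg–Häggström–Kahn Thm. 1.3 given `{o ↮ xᵢ}`, for the increasing events
"`x_k ∈ C(o)`" and "`x_j, x_l ∈ C(o)`" of the cluster of `o`):
`μ(o↮xᵢ, o↔x_k) · μ(o↮xᵢ, o↔x_j, o↔x_l) ≤ μ(o↮xᵢ) · μ(o↮xᵢ, o↔x_k, o↔x_j, o↔x_l)`.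
[cite: VandenbergHaggstromKahn2005, Thm. 1.3 (p. 6)] -/
theorem key (w : Sym2 (Fin n) → unitInterval) (o : Fin n) (xi xk xj xl : Fin n) (hi : xi ≠ o) (hk : xk ≠ o)
    (hj : xj ≠ o) (hl : xl ≠ o) :
    (prodBernoulli w).real ((openConn o xi)ᶜ ∩ openConn o xk) *
        (prodBernoulli w).real ((openConn o xi)ᶜ ∩ (openConn o xj ∩ openConn o xl)) ≤
      (prodBernoulli w).real (openConn o xi)ᶜ *
        (prodBernoulli w).real ((openConn o xi)ᶜ ∩ (openConn o xk ∩ (openConn o xj ∩ openConn o xl))) := by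
  -- the two upper families of edge sets: "some edge of the cluster contains `x_k`" and "… `x_j` and … `x_l`"
  set 𝒜 : Set (Set (Sym2 (Fin n))) := {C | ∃ e ∈ C, xk ∈ e} with h𝒜
  set ℬ : Set (Set (Sym2 (Fin n))) := {C | (∃ e ∈ C, xj ∈ e) ∧ ∃ e ∈ C, xl ∈ e} with hℬ
  have h𝒜up : IsUpperSet 𝒜 := fun C C' hCC' ⟨e, he, hke⟩ => ⟨e, hCC' he, hke⟩
  have hℬup : IsUpperSet ℬ := fun C C' hCC' ⟨⟨e, he, hje⟩, ⟨e', he', hle'⟩⟩ => ⟨⟨e, hCC' he, hje⟩, ⟨e', hCC' he', hle'⟩⟩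
  have hoX : o ∉ ({xi} : Set (Fin n)) := by simpa using hi.symm
  have hbhk := KNPreFKG.bhk_one_upper_upper w o ({xi} : Set (Fin n)) hoX h𝒜up hℬup
  -- identify the events
  have hD : {ω : BondConfig (Fin n) | ∀ y ∈ ({xi} : Set (Fin n)), ¬ (openGraph ω).Reachable o y} = (openConn o xi)ᶜ := by
    ext ω; simp [openConn]
  have hreach : ∀ (y : Fin n), y ≠ o → ∀ ω : BondConfig (Fin n),
      (∃ e ∈ openEdgeCluster ω o, y ∈ e) ↔ ω ∈ openConn o y := by
    intro y hy ω
    rw [show (ω ∈ openConn o y) = (openGraph ω).Reachable o y from rfl, reachable_iff_exists_mem_openEdgeCluster]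
    constructor
    · exact fun h => Or.inr h
    · rintro (h | h)
      · exact absurd h hy
      · exact h
  have hA : {ω : BondConfig (Fin n) | openEdgeCluster ω o ∈ 𝒜} = openConn o xk := by
    ext ω; simp only [h𝒜, mem_setOf_eq]; exact hreach xk hk ω
  have hB : {ω : BondConfig (Fin n) | openEdgeCluster ω o ∈ ℬ} = openConn o xj ∩ openConn o xl := by
    ext ω
    simp only [hℬ, mem_setOf_eq, mem_inter_iff]
    exact and_congr (hreach xj hj ω) (hreach xl hl ω)
  rw [hD, hA, hB] at hbhk
  simpa only [inter_assoc] using hbhk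

end Five

open Five in
/-- **Anti-halving for four relay points seen from a fifth.**  Observer `o` and four further points `x 0, …, x 3` (all `≠ o`),
all pairwise unreliabilities among the five points `≤ s`: the probability that `o` is cut from AT LEAST TWO of the four is
`≤ (3/2)·s`.  Pointwise pair charging gives only `7/4`; the missing `1/4` comes from vdBHK Thm. 1.3 (`Five.key`) through the
certificate `Five.core`.  Sharp: the hub-leaf gadget (`…LinearLowerTailHubLeaf`) has `3q` against `s = 2q − q²`.
[cite: VandenbergHaggstromKahn2005, Thm. 1.3 (p. 6)] -/
theorem real_two_le_lost_le_three_halves (n : ℕ) (w : Sym2 (Fin n) → unitInterval) (o : Fin n) (x : Fin 4 → Fin n)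
    (hxo : ∀ k, x k ≠ o) {s : ℝ} (hso : ∀ k, (prodBernoulli w).real (openConn o (x k))ᶜ ≤ s)
    (hss : ∀ k k', (prodBernoulli w).real (openConn (x k) (x k'))ᶜ ≤ s) :
    (prodBernoulli w).real {ω | 2 ≤ (Finset.univ.filter fun k => ω ∉ openConn o (x k)).card} ≤ 3 / 2 * s := by
  set μ := prodBernoulli w with hμ
  set e : Finset (Fin 4) → ℝ := fun T => μ.real {ω | (Finset.univ.filter fun k => ω ∉ openConn o (x k)) = T} with he_def
  have he : ∀ T, 0 ≤ e T := fun T => measureReal_nonneg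
  -- (1) observer budgets `μ(o ↮ x i) ≤ s` as fibre sums
  have hb : ∀ i : Fin 4, (∑ T, if i ∈ T then e T else 0) ≤ s := fun i => by
    rw [← real_setOf_lostSet w o x (fun L => i ∈ L)]
    exact le_trans (measureReal_mono fun ω hω => by simpa [Finset.mem_filter] using hω) (hso i)
  have hb0' := hb 0; have hb1' := hb 1; have hb2' := hb 2; have hb3' := hb 3
  simp only [sum_finset_fin4] at hb0' hb1' hb2' hb3'
  simp [Finset.mem_insert, Finset.mem_singleton] at hb0' hb1' hb2' hb3'
  -- (2) relay-pair budgets: if exactly one of `x i`, `x k` is joined to `o` then `x i ↮ x k`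
  have hP : ∀ i k : Fin 4, (∑ T, if (i ∈ T ∧ k ∉ T) ∨ (i ∉ T ∧ k ∈ T) then e T else 0) ≤ s := fun i k => by
    rw [← real_setOf_lostSet w o x (fun L => (i ∈ L ∧ k ∉ L) ∨ (i ∉ L ∧ k ∈ L))]
    refine le_trans (measureReal_mono fun ω hω => ?_) (hss i k)
    simp only [mem_setOf_eq, Finset.mem_filter, Finset.mem_univ, true_and, not_not] at hω
    intro hik
    have hik' : (openGraph ω).Reachable (x i) (x k) := hik
    rcases hω with ⟨hi, hk⟩ | ⟨hi, hk⟩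
    · exact hi (SimpleGraph.Reachable.trans hk hik'.symm)
    · exact hk (SimpleGraph.Reachable.trans hi hik')
  have hp01' := hP 0 1; have hp02' := hP 0 2; have hp12' := hP 1 2; have hp13' := hP 1 3; have hp23' := hP 2 3
  simp only [sum_finset_fin4] at hp01' hp02' hp12' hp13' hp23'
  simp [Finset.mem_insert, Finset.mem_singleton] at hp01' hp02' hp12' hp13' hp23'
  -- (3) the four positive-association inequalities (`Five.key`) as fibre sums
  have hK : ∀ i k j l : Fin 4,
      (∑ T, if i ∈ T ∧ k ∉ T then e T else 0) * (∑ T, if i ∈ T ∧ (j ∉ T ∧ l ∉ T) then e T else 0) ≤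
        (∑ T, if i ∈ T then e T else 0) * (∑ T, if i ∈ T ∧ (k ∉ T ∧ (j ∉ T ∧ l ∉ T)) then e T else 0) := fun i k j l => by
    rw [← real_setOf_lostSet w o x (fun L => i ∈ L ∧ k ∉ L), ← real_setOf_lostSet w o x (fun L => i ∈ L ∧ (j ∉ L ∧ l ∉ L)),
      ← real_setOf_lostSet w o x (fun L => i ∈ L), ← real_setOf_lostSet w o x (fun L => i ∈ L ∧ (k ∉ L ∧ (j ∉ L ∧ l ∉ L)))]
    have h := key w o (x i) (x k) (x j) (x l) (hxo i) (hxo k) (hxo j) (hxo l)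
    have h1 : (openConn o (x i))ᶜ ∩ openConn o (x k) = {ω | i ∈ (Finset.univ.filter fun k => ω ∉ openConn o (x k)) ∧ k ∉ (Finset.univ.filter fun k => ω ∉ openConn o (x k))} := by
      ext ω; simp [Finset.mem_filter]
    have h2 : (openConn o (x i))ᶜ ∩ (openConn o (x j) ∩ openConn o (x l)) =
        {ω | i ∈ (Finset.univ.filter fun k => ω ∉ openConn o (x k)) ∧ (j ∉ (Finset.univ.filter fun k => ω ∉ openConn o (x k)) ∧ l ∉ (Finset.univ.filter fun k => ω ∉ openConn o (x k)))} := by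
      ext ω; simp [Finset.mem_filter]
    have h3 : (openConn o (x i))ᶜ = {ω | i ∈ (Finset.univ.filter fun k => ω ∉ openConn o (x k))} := by
      ext ω; simp [Finset.mem_filter]
    have h4 : (openConn o (x i))ᶜ ∩ (openConn o (x k) ∩ (openConn o (x j) ∩ openConn o (x l))) =
        {ω | i ∈ (Finset.univ.filter fun k => ω ∉ openConn o (x k)) ∧ (k ∉ (Finset.univ.filter fun k => ω ∉ openConn o (x k)) ∧ (j ∉ (Finset.univ.filter fun k => ω ∉ openConn o (x k)) ∧ l ∉ (Finset.univ.filter fun k => ω ∉ openConn o (x k))))} := by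
      ext ω; simp [Finset.mem_filter]
    rw [h4, h2, h1, h3] at h
    exact h
  have hk02' := hK 0 2 1 3; have hk20' := hK 2 0 1 3; have hk13' := hK 1 3 0 2; have hk31' := hK 3 1 0 2
  simp only [sum_finset_fin4] at hk02' hk20' hk13' hk31'
  simp [Finset.mem_insert, Finset.mem_singleton] at hk02' hk20' hk13' hk31'
  -- (4) the target event
  rw [real_setOf_lostSet w o x (fun L => 2 ≤ L.card), sum_finset_fin4]
  simp [Finset.card_insert_of_notMem, Finset.mem_insert, Finset.mem_singleton]
  exact Five.core e s he hb0' hb1' hb2' hb3' hp01' hp02' hp12' hp13' hp23' hk02' hk20' hk13' hk31'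

open Five in
/-- **(LT³⁄₂) for `o ∈ A`, `|A| ≤ 5`, every `κ ≤ 2/3`** (all finite weighted graphs, all `s`):
`P(1 ≤ N < κ·EN) ≤ (3/2)·s`.  For `|A| ≤ 4` this is `Consts.real_lowerTail_le_three_halves_of_card_le` (`κ|A| ≤ 8/3 ≤ 3`);
for `|A| = 5` the bad event forces `N ≤ 3` (as `κ·EN ≤ 10/3`), i.e. `o` cut from at least two of the other four relay points,
and `Consts.real_two_le_lost_le_three_halves` applies.  This is the first case of the conjecture not reachable by pair-marginal
(pointwise) arguments, whose value here is `7/4`. [cite: KozmaNitzan2024, Conj. 1 (p. 3)] -/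
theorem real_lowerTail_le_three_halves_of_card_le_five (n : ℕ) (w : Sym2 (Fin n) → unitInterval) (A : Finset (Fin n))
    (o : Fin n) (ho : o ∈ A) (hA : A.card ≤ 5) {κ s : ℝ} (hκ : κ ≤ 2 / 3)
    (hrel : ∀ a ∈ A, ∀ a' ∈ A, (prodBernoulli w).real (openConn a a')ᶜ ≤ s) :
    (prodBernoulli w).real {ω : BondConfig (Fin n) | 1 ≤ (A.filter fun a => ω ∈ openConn o a).card ∧
        ((A.filter fun a => ω ∈ openConn o a).card : ℝ) < κ * (∑ a ∈ A, (prodBernoulli w).real (openConn o a))} ≤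
      3 / 2 * s := by
  set μ := prodBernoulli w with hμ
  by_cases h4 : A.card ≤ 4
  · have hκA : κ * A.card ≤ 3 := by
      have : (A.card : ℝ) ≤ 4 := by exact_mod_cast h4
      have hM0 : (0 : ℝ) ≤ A.card := Nat.cast_nonneg _
      nlinarith
    exact real_lowerTail_le_three_halves_of_card_le n w A o ho (by linarith) hκA hrel
  have h5 : A.card = 5 := by omega
  -- enumerate the four other relay points
  set B := A.erase o with hB
  have hBcard : B.card = 4 := by rw [hB, Finset.card_erase_of_mem ho, h5]
  set ε := B.equivFinOfCardEq hBcard with hε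
  set x : Fin 4 → Fin n := fun k => ((ε.symm k : B) : Fin n) with hx
  have hxB : ∀ k, x k ∈ B := fun k => (ε.symm k).2
  have hxo : ∀ k, x k ≠ o := fun k => (Finset.mem_erase.1 (hxB k)).1
  have hxA : ∀ k, x k ∈ A := fun k => (Finset.mem_erase.1 (hxB k)).2
  have hxinj : Function.Injective x := by
    intro k k' hkk'
    have : ε.symm k = ε.symm k' := Subtype.ext hkk'
    exact ε.symm.injective this
  -- `B` is the image of `x`
  have hBmap : B = Finset.univ.map ⟨x, hxinj⟩ := by
    ext a
    simp only [Finset.mem_map, Finset.mem_univ, Function.Embedding.coeFn_mk, true_and]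
    constructor
    · intro ha
      exact ⟨ε ⟨a, ha⟩, by simp [hx]⟩
    · rintro ⟨k, rfl⟩
      exact hxB k
  -- budgets among the five points
  have hso : ∀ k, μ.real (openConn o (x k))ᶜ ≤ s := fun k => hrel o ho (x k) (hxA k)
  have hss : ∀ k k', μ.real (openConn (x k) (x k'))ᶜ ≤ s := fun k k' => hrel (x k) (hxA k) (x k') (hxA k')
  -- the bad event forces `o` to lose at least two of the four
  refine le_trans (measureReal_mono ?_) (real_two_le_lost_le_three_halves n w o x hxo hso hss)
  intro ω hω
  simp only [mem_setOf_eq] at hω ⊢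
  obtain ⟨_, hlt⟩ := hω
  -- `EN ≤ 5`
  have hEN : (∑ a ∈ A, μ.real (openConn o a)) ≤ 5 := by
    calc (∑ a ∈ A, μ.real (openConn o a)) ≤ ∑ a ∈ A, (1 : ℝ) :=
          Finset.sum_le_sum fun a _ => measureReal_le_one
      _ = 5 := by simp [h5]
  -- `N = 1 + #{k : x k kept} = 5 − |lost set|`
  have hN : (A.filter fun a => ω ∈ openConn o a).card + (Finset.univ.filter fun k => ω ∉ openConn o (x k)).card = 5 := by
    have hAins : A = insert o B := by rw [hB, Finset.insert_erase ho]
    have hoo : ω ∈ openConn o o := SimpleGraph.Reachable.refl _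
    have hoB : o ∉ B := by rw [hB]; exact Finset.notMem_erase o A
    rw [hAins, Finset.filter_insert, if_pos hoo, Finset.card_insert_of_notMem (fun h => hoB (Finset.mem_filter.1 h).1)]
    -- kept and lost among `B`, transported along `x`
    have hkept : (B.filter fun a => ω ∈ openConn o a).card =
        (Finset.univ.filter fun k : Fin 4 => ω ∈ openConn o (x k)).card := by
      rw [hBmap, Finset.filter_map, Finset.card_map]
      rfl
    have hsplit := Finset.card_filter_add_card_filter_not (s := (Finset.univ : Finset (Fin 4)))
      (fun k : Fin 4 => ω ∈ openConn o (x k))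
    rw [Finset.card_univ, Fintype.card_fin] at hsplit
    rw [hkept]
    omega
  have hEN0 : (0 : ℝ) ≤ ∑ a ∈ A, μ.real (openConn o a) := Finset.sum_nonneg fun a _ => measureReal_nonneg
  have hN3 : ((A.filter fun a => ω ∈ openConn o a).card : ℝ) < 4 := by
    have : κ * (∑ a ∈ A, μ.real (openConn o a)) ≤ 2 / 3 * 5 := by nlinarith
    linarith
  have hN3' : (A.filter fun a => ω ∈ openConn o a).card ≤ 3 := by
    have : ((A.filter fun a => ω ∈ openConn o a).card : ℝ) < 4 := hN3
    exact_mod_cast Nat.lt_succ_iff.1 (by exact_mod_cast this)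
  omega

/-- **(LT³⁄₂) for `|A| ≤ 5` with `o ∈ A`, in the conjecture's quantifier shape** (`Consts.LinearLowerTailThreeHalves` restricted
to `o ∈ A ∧ |A| ≤ 5`). [cite: KozmaNitzan2024, Conj. 1 (p. 3)] -/
theorem linearLowerTailThreeHalves_of_card_le_five :
    ∀ κ : ℝ, 0 < κ → κ ≤ 2 / 3 →
      ∀ (n : ℕ) (w : Sym2 (Fin n) → unitInterval) (A : Finset (Fin n)) (o : Fin n) (s : ℝ), 0 ≤ s →
        o ∈ A → A.card ≤ 5 →
        (∀ a ∈ A, ∀ a' ∈ A, (prodBernoulli w).real (openConn a a')ᶜ ≤ s) →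
        (prodBernoulli w).real {ω : BondConfig (Fin n) | 1 ≤ (A.filter fun a => ω ∈ openConn o a).card ∧
            ((A.filter fun a => ω ∈ openConn o a).card : ℝ) < κ * (∑ a ∈ A, (prodBernoulli w).real (openConn o a))} ≤
          3 / 2 * s := by
  intro κ _ hκ n w A o s _ ho hA hrel
  exact real_lowerTail_le_three_halves_of_card_le_five n w A o ho hA hκ hrel

end Consts

end Summit.CriticalPhenomena.PercolationContinuityZ3.Theorems
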